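import Summits.CriticalPhenomena.PercolationContinuityZ3.Theorems.PercNearOneGluingNoHeavyLowerTailSahiGridPatternThreeStarKernel

/-!
# `NoHeavyLowerTail` (crux stmt-CriticalPhenomena-4575), Sahi programme P1: **LITERAL ABSORPTION WITH CERTIFICATES** — if an up-set
# `U' ⊆ [3]^k` carries a diagonal certificate, so does `{ξ = 2} ∪ cyl(U') ⊆ [3]^{1+k}` (the inductive step of the star theorem)

Support file (Sahi cell, seat `prim-sahi-p1`, generation 22; `--supports stmt-CriticalPhenomena-4575`).  Pure proofs, no definitions,
no `sorry`, standard axioms.  Vocabulary of `…SahiGridPattern{CellForm,DiagCert,PairCert,ThreeStarPrelim,ThreeStarKernel}`.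

THE MATHEMATICS.  Let `U' ⊆ [3]^k` be an up-set with a DIAGONAL CERTIFICATE `d'` (`d' ≥ 0`, (T) `Σ_W d' ≤ Σ_W λ_{U'}`, (N) `Θ_{U'}(P×Q) ≤ Σ_{P∩Q} d'`,
all up-sets; `…DiagCert`).  Glue a literal axis in front: `[3]^{1+k} ∋ glue ξ z`, `X = {ξ = 2} × [3]^k` (trace `↑ℓ`, `ℓ 0 = 2`), `Y = [3] × U'`,
`U = X ∪ Y`.  THEOREM (literal-2 absorption): the vector
  `d(glue ξ z) = d_pair(glue ξ z) + [ξ ≠ 2]·(d'(z) − 2^k·1_{U'}(z))`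
(`d_pair` the pair certificate of `X ∪ Y`, `X` pays) is a diagonal certificate of `U`: `d ≥ 0` (`litAbsorb_cert_nonneg`), (T) (`litAbsorb_cert_T`:
slack `2^k Σ_z (1−1_{U'}(z))(2·1_W(2,z) − 1_W(0,z) − 1_W(1,z)) + Σ_{i∈{0,1}}[(T)-slack of d' at W_i]`), and (N) (`litAbsorb_cert_N`), by the identity
  `Σ_{A∩A'} d − Θ_U(A×A') = Σ_{i∈{0,1}} [H(A'_i ∩ U'; A_2) + H(A_i ∩ U'; A'_2)] + 2K(Ū'; A_2, A'_2) + F'(A_0,A'_1) + F'(A_1,A'_0)`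
  `      + Σ_z d'(z)·D_{01}(z) + 2^k Σ_z 1_{U'}(z)(D_{02} + D_{12})(z) + Σ_{(z,z',z'') Latin} (1 − 1_{U'}(z''))·Q_E(z,z')`
(`A_i = sect A i`, `H` coefficientwise Harris, `K` fibre Kleitman, `F'(P,Q) = Σ_{P∩Q} d' − Θ_{U'}(P×Q) ≥ 0` by (N) for `d'`,
`D_{ij}(z) = (1_A(j,z) − 1_A(i,z))(1_{A'}(j,z) − 1_{A'}(i,z)) ≥ 0`, `Q_E(z,z') = (a_2−a_0)(z)(a'_2−a'_1)(z') + (a_2−a_1)(z)(a'_2−a'_0)(z') ≥ 0`):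
the two-orthant identity of generation 21 with the non-positive Conjecture-P terms of the non-principal block `U'` traded for the
inner certificate (`G(U';P,Q) = F'(P,Q) − Σ_{P∩Q}(d' − 2^k 1_{U'})`) — the pair-sum part is a polynomial identity in 21 indeterminates after
6-fold symmetrisation (`ring`), the single-sum (`d'`) part cancels pointwise.  CONSEQUENCE (`sStarD_cylSet_litAbsorb_nonneg`): `U × [3]^m` is a
good first slot in every dimension; and since the OUTPUT is again a diagonal certificate, the step ITERATES: with the principal certificate
(Conjecture P), the pair certificate of two orthants (`…TwoOrthant`) and the threshold-1 literal (`…TwoOrthantLiteral`) as bases, every star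
(read-once monotone DNF pattern) with at most two multi-axis blocks follows by induction (sequel).  Found via the seat's recursive-certificate
computation (gen 22 memo).  Nothing here asserts `PatternPos d` for `d ≥ 4`. [this work]
-/

namespace Summit.CriticalPhenomena.PercolationContinuityZ3.Theorems.SahiGridPattern

open Finset SahiGrid3
open scoped BigOperators

variable {k : ℕ}

/-- `Θ` as a weighted kernel. [this work] -/
theorem thetaVal_eq_ite_mul {d : ℕ} (U : Finset (Pd d)) (q r : Pd d) :
    thetaVal U q r = (if TotDist q r = true then (1:ℤ) else 0) * (ind U q + ind U r - ind U (thirdPt q r)) := by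
  unfold thetaVal
  split_ifs <;> ring

/-- Indicator of a glued point in the literal block (general cell dimension). [this work] -/
theorem ind_free_literalTwo_vals {X : Finset (Pd (1 + k))} (ℓ : Pd 1) (hℓ : ℓ 0 = 2)
    (hX : ∀ ξ z, glue ξ z ∈ X ↔ ξ ∈ (univ.filter fun y : Pd 1 => ∀ j, ℓ j ≤ y j)) (z : Pd k) :
    ind X (glue (fun _ => 0) z) = 0 ∧ ind X (glue (fun _ => 1) z) = 0 ∧ ind X (glue (fun _ => 2) z) = 1 := by
  obtain ⟨i0, i1, i2⟩ := ind_literalTwo_vals ℓ hℓ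
  rw [ind_glue_of_free hX, ind_glue_of_free hX, ind_glue_of_free hX]
  exact ⟨i0, i1, i2⟩

/-! ### The certificate: nonnegativity and condition (T) -/

/-- **The literal-absorption certificate is nonnegative** (`d' ≥ 0` suffices). [this work] -/
theorem litAbsorb_cert_nonneg {U' : Finset (Pd k)} (d' : Pd k → ℤ) (hd' : ∀ z, 0 ≤ d' z) {X Y : Finset (Pd (1 + k))}
    (hY : ∀ ξ z, glue ξ z ∈ Y ↔ z ∈ U') (x : Pd (1 + k)) :
    0 ≤ (2:ℤ) ^ (1 + k) * (ind X x + ind Y x) - ind X x * ((nuCount (X ∪ Y) x : ℤ) - nuCount X x)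
        - ind X x * ind Y x * (nuCount X x : ℤ)
        + (1 - ind X x) * (d' (cellOf x) - 2 ^ k * ind U' (cellOf x)) := by
  have h3 := pairCert_nonneg X Y x
  have h2 := hd' (cellOf x)
  by_cases hx : x ∈ X
  · have e : ind X x = 1 := by unfold ind; rw [if_pos hx]
    rw [e] at h3 ⊢
    nlinarith [h3]
  · have e : ind X x = 0 := by unfold ind; rw [if_neg hx]
    have eY : ind Y x = ind U' (cellOf x) := by
      have hm : x ∈ Y ↔ cellOf x ∈ U' := by
        have := hY (freeOf x) (cellOf x); rwa [glue_freeOf_cellOf] at this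
      unfold ind
      by_cases hy : x ∈ Y
      · rw [if_pos hy, if_pos (hm.1 hy)]
      · rw [if_neg hy, if_neg (fun h => hy (hm.2 h))]
    rw [e, eY]
    have hU := ind_nonneg' U' (cellOf x)
    have hp : (2:ℤ) ^ (1 + k) = 2 * 2 ^ k := by rw [pow_add]; ring
    rw [hp]
    nlinarith [h2, hU, pow_nonneg (show (0:ℤ) ≤ 2 by norm_num) k]

/-- **Condition (T) for the literal-absorption certificate** (from (T) for `d'` at the two sections `W_0, W_1`, plus chains). [this work] -/
theorem litAbsorb_cert_T (ℓ : Pd 1) (hℓ : ℓ 0 = 2) {U' : Finset (Pd k)} (d' : Pd k → ℤ)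
    (hT' : ∀ W : Finset (Pd k), IsUpperSet (W : Set (Pd k)) → (∑ z ∈ W, d' z) ≤ ∑ z ∈ W, lamU U' z)
    {X Y : Finset (Pd (1 + k))}
    (hX : ∀ ξ z, glue ξ z ∈ X ↔ ξ ∈ (univ.filter fun y : Pd 1 => ∀ j, ℓ j ≤ y j)) (hY : ∀ ξ z, glue ξ z ∈ Y ↔ z ∈ U')
    (W : Finset (Pd (1 + k))) (hW : IsUpperSet (W : Set (Pd (1 + k)))) :
    (∑ x ∈ W, ((2:ℤ) ^ (1 + k) * (ind X x + ind Y x) - ind X x * ((nuCount (X ∪ Y) x : ℤ) - nuCount X x)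
        - ind X x * ind Y x * (nuCount X x : ℤ)
        + (1 - ind X x) * (d' (cellOf x) - 2 ^ k * ind U' (cellOf x))))
      ≤ ∑ x ∈ W, lamU (X ∪ Y) x := by
  set L : Finset (Pd 1) := (univ.filter fun y : Pd 1 => ∀ j, ℓ j ≤ y j) with hL
  have eΦ := pairCert_slack_eq hX hY W
  rw [Finset.sum_add_distrib]
  rw [Finset.sum_sub_distrib] at eΦ
  suffices hδ : (∑ x ∈ W, (1 - ind X x) * (d' (cellOf x) - 2 ^ k * ind U' (cellOf x)))
      ≤ 2 ^ k * (∑ z : Pd k, (1 - ind U' z) * ∑ ξ : Pd 1, ind (fibre W z) ξ * (2 ^ 1 * ind L ξ - (nuCount L ξ : ℤ)))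
        + ∑ ξ : Pd 1, (1 - ind L ξ) * (2 ^ 1 - (nuCount L ξ : ℤ)) *
            ∑ z : Pd k, ind (sect W ξ) z * (2 ^ k * ind U' z - (nuCount U' z : ℤ)) by
    linarith
  obtain ⟨i0, i1, i2⟩ := ind_literalTwo_vals ℓ hℓ
  obtain ⟨n0, n1, n2⟩ := nuCount_literalTwo_vals ℓ hℓ
  rw [← hL] at i0 i1 i2 n0 n1 n2
  have eδ : (∑ x ∈ W, (1 - ind X x) * (d' (cellOf x) - 2 ^ k * ind U' (cellOf x)))
      = (∑ z : Pd k, ind W (glue (fun _ => 0) z) * (d' z - 2 ^ k * ind U' z))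
        + ∑ z : Pd k, ind W (glue (fun _ => 1) z) * (d' z - 2 ^ k * ind U' z) := by
    rw [sum_mem_eq_sum_ind_mul, sum_glue, sum_pd1]
    simp only [cellOf_glue, (ind_free_literalTwo_vals ℓ hℓ hX _).1, (ind_free_literalTwo_vals ℓ hℓ hX _).2.1,
      (ind_free_literalTwo_vals ℓ hℓ hX _).2.2]
    have hz : (∑ z : Pd k, ind W (glue (fun _ => (2:Fin 3)) z) * ((1 - 1) * (d' z - 2 ^ k * ind U' z))) = 0 :=
      Finset.sum_eq_zero fun z _ => by ring
    rw [hz, add_zero, ← Finset.sum_add_distrib, ← Finset.sum_add_distrib]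
    refine Finset.sum_congr rfl fun z _ => ?_
    ring
  have eA : (∑ z : Pd k, (1 - ind U' z) * ∑ ξ : Pd 1, ind (fibre W z) ξ * (2 ^ 1 * ind L ξ - (nuCount L ξ : ℤ)))
      = ∑ z : Pd k, (1 - ind U' z) * (2 * ind W (glue (fun _ => 2) z) - ind W (glue (fun _ => 0) z) - ind W (glue (fun _ => 1) z)) := by
    refine Finset.sum_congr rfl fun z _ => ?_
    rw [sum_pd1, ind_fibre, ind_fibre, ind_fibre, i0, i1, i2, n0, n1, n2]
    ring
  have eB : (∑ ξ : Pd 1, (1 - ind L ξ) * (2 ^ 1 - (nuCount L ξ : ℤ)) *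
            ∑ z : Pd k, ind (sect W ξ) z * (2 ^ k * ind U' z - (nuCount U' z : ℤ)))
      = (∑ z : Pd k, ind W (glue (fun _ => 0) z) * (2 ^ k * ind U' z - (nuCount U' z : ℤ)))
        + ∑ z : Pd k, ind W (glue (fun _ => 1) z) * (2 ^ k * ind U' z - (nuCount U' z : ℤ)) := by
    rw [sum_pd1, i0, i1, i2, n0, n1, n2]
    simp only [ind_sect]
    ring
  rw [eδ, eA, eB]
  have hchain : 0 ≤ ∑ z : Pd k, (1 - ind U' z) *
      (2 * ind W (glue (fun _ => 2) z) - ind W (glue (fun _ => 0) z) - ind W (glue (fun _ => 1) z)) := by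
    refine Finset.sum_nonneg fun z _ => mul_nonneg (by linarith [ind_le_one' U' z]) ?_
    have c02 : ((fun _ => 0 : Pd 1) ≤ fun _ => 2) := fun _ => by show (0 : Fin 3) ≤ 2; decide
    have c12 : ((fun _ => 1 : Pd 1) ≤ fun _ => 2) := fun _ => by show (1 : Fin 3) ≤ 2; decide
    have le0 : ind W (glue (fun _ => 0) z) ≤ ind W (glue (fun _ => 2) z) :=
      ind_le_ind_of_imp fun h => hW (glue_le_glue_iff.2 ⟨c02, le_rfl⟩) h
    have le1 : ind W (glue (fun _ => 1) z) ≤ ind W (glue (fun _ => 2) z) :=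
      ind_le_ind_of_imp fun h => hW (glue_le_glue_iff.2 ⟨c12, le_rfl⟩) h
    linarith
  have hsec : ∀ ξ : Pd 1, (∑ z : Pd k, ind W (glue ξ z) * (d' z - 2 ^ k * ind U' z))
      ≤ ∑ z : Pd k, ind W (glue ξ z) * (2 ^ k * ind U' z - (nuCount U' z : ℤ)) := by
    intro ξ
    have hT := hT' (sect W ξ) (isUpperSet_sect hW ξ)
    rw [sum_mem_eq_sum_ind_mul (sect W ξ), sum_mem_eq_sum_ind_mul (sect W ξ)] at hT
    simp only [ind_sect] at hT
    have e1 : (∑ z : Pd k, ind W (glue ξ z) * (2 ^ k * ind U' z - (nuCount U' z : ℤ)))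
        - (∑ z : Pd k, ind W (glue ξ z) * (d' z - 2 ^ k * ind U' z))
        = (∑ z : Pd k, ind W (glue ξ z) * lamU U' z) - ∑ z : Pd k, ind W (glue ξ z) * d' z := by
      rw [← Finset.sum_sub_distrib, ← Finset.sum_sub_distrib]
      refine Finset.sum_congr rfl fun z _ => ?_
      unfold lamU; ring
    linarith
  have h0 := hsec (fun _ => 0)
  have h1 := hsec (fun _ => 1)
  have hpos : (0:ℤ) ≤ 2 ^ k := pow_nonneg (by norm_num) _
  have hc := mul_nonneg hpos hchain
  linarith

/-! ### Condition (N): reduction to the core inequality, and the core identity -/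

/-- **Condition (N) from the core inequality** (bookkeeping, as `threeStar_N_of_core`). [this work] -/
theorem litAbsorb_N_of_core {U' : Finset (Pd k)} (d' : Pd k → ℤ) {X Y : Finset (Pd (1 + k))} {L : Finset (Pd 1)}
    (hX : ∀ ξ z, glue ξ z ∈ X ↔ ξ ∈ L) (hY : ∀ ξ z, glue ξ z ∈ Y ↔ z ∈ U')
    (hcore : ∀ A A' : Finset (Pd (1 + k)), IsUpperSet (A : Set (Pd (1 + k))) → IsUpperSet (A' : Set (Pd (1 + k))) →
      0 ≤ (sStarD (X ∪ Y) A A'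
        - (2 ^ k * (∑ z : Pd k, (1 - ind U' z) * ∑ ξ : Pd 1, ind (fibre (A ∩ A') z) ξ * (2 ^ 1 * ind L ξ - (nuCount L ξ : ℤ)))
          + (∑ ξ : Pd 1, (1 - ind L ξ) * (2 ^ 1 - (nuCount L ξ : ℤ)) *
              ∑ z : Pd k, ind (sect (A ∩ A') ξ) z * (2 ^ k * ind U' z - (nuCount U' z : ℤ)))))
        + ∑ x ∈ A ∩ A', (1 - ind X x) * (d' (cellOf x) - 2 ^ k * ind U' (cellOf x))) :
    ∀ A A' : Finset (Pd (1 + k)), IsUpperSet (A : Set (Pd (1 + k))) → IsUpperSet (A' : Set (Pd (1 + k))) →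
      (∑ q ∈ A, ∑ r ∈ A', thetaVal (X ∪ Y) q r) ≤
        ∑ x ∈ A ∩ A', ((2:ℤ) ^ (1 + k) * (ind X x + ind Y x) - ind X x * ((nuCount (X ∪ Y) x : ℤ) - nuCount X x)
        - ind X x * ind Y x * (nuCount X x : ℤ)
        + (1 - ind X x) * (d' (cellOf x) - 2 ^ k * ind U' (cellOf x))) := by
  intro A A' hA hA'
  have h1 := sStarD_eq_sum_lamU_sub_sum_thetaVal (X ∪ Y) A A'
  have h2 := pairCert_slack_eq hX hY (A ∩ A')
  have h3 := hcore A A' hA hA'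
  rw [Finset.sum_sub_distrib] at h2
  rw [Finset.sum_add_distrib]
  linarith

end Summit.CriticalPhenomena.PercolationContinuityZ3.Theorems.SahiGridPattern
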